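import Summits.QuantumFields.YangMills.Theorems.BalabanUVNodesN27AtRecord

/-!
# BalabanUVNodes ∕ N27 = binder B5 AT THE RECORD, XVI — WHAT B5 READS OF THE DATUM: only the construction `D.C` and the averaging maps `D.av`
# (congruence of `T4ApexHybrid.HybridNE7Under` under `(C, av)`-agreement), hence the (W2′) SHADOW closer for `Spine`: B5 at a record predicate
# transfers to every record predicate whose data have `(C, av)`-agreeing SHADOWS in it (plan [YMPLAN-G62-WORD-RECORD9] (W2′), chair R447)
# (cell `pub-ymgap`, HUMAN RULING D-0062 Track A, seat `pub-ymgap-dag-n27-a` g4; `--supports stmt-QuantumFields-19182`, count-neutral)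

WHY.  The plan's acceptance read of NODE 00's `Record9` design located COST 2: a ₉C record does NOT refine ₅C ∕ ₇C ∕ ₈C at the DATUM — only at a
SHADOW datum with the same world and agreeing `C ∕ dens ∕ βfun ∕ av` — so refinement-generic closers `s_N0x_of_refines₅C` do not fire at `Rec := ₉C`;
the -a seats' AT-RECORD modules should (i) say through which fields of the datum the node's face reads it (a congruence lemma), (ii) add a SHADOW
closer.  For N27 the face is `T4ApexHybrid.HybridNE7Under D (DagBinding.EndpointExistence D.C.toB12)` = `(B)(D.C) → END(D.C) → ForSmallCouplings D
(g₀ ↦ StringwiseHybridNE7 (D.scheme g₀))`: the prefix reads `D.C` (`(B)`, END, `D.Tuned`), the conclusion reads the Wilson scheme `D.scheme g₀`, whose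
only datum-dependence is the observables `D.avgObs K C U = loopAt (Averaging.iter (D.av K) K U) …` — i.e. `D.av`.  Neither `D.βfun` nor the densities
`D.real` ∕ `D.dens` are read (the term classes, weights and remainders are EXISTENTIAL inside `StringwiseHybridNE7`).  Hence B5 is CONGRUENT under
`(C, av)`-agreement, and `Spine` transfers along shadows.

WHAT IS KERNEL-CHECKED ([bookkeeping]; 0 `def`, 0 `sorry`).
* §1 `avgObs_congr_av` ∕ `scheme_congr_av` (`D'.av = D.av ⇒ D'.scheme = D.scheme`) · `tuned_congr_C` (`D'.C = D.C ⇒ D'.Tuned = D.Tuned`) ·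
  `forSmallCouplings_congr_C` · **`hybridNE7Under_congr`** (`D'.C = D.C → D'.av = D.av → (HybridNE7Under D' Hβ ↔ HybridNE7Under D Hβ)`) ·
  **`b5_congr`** (the same with `Hβ := END` of the respective constructions).
* §2 (record level) **`spine_of_shadow`**: if every record pair `(D, w)` of `Rec` has a SHADOW `D'` with `Rec' F D' w`, `D'.C = D.C`, `D'.av = D.av`,
  then `Spine Rec' → Spine Rec` — the (W2′) closer for the composite node (with `Rec' := ₅C`, `Rec := ₉C` it is the shape NODE 00's shadow lemma
  feeds); `spine_iff_of_biShadow` (mutual shadows ⇒ `Spine Rec ↔ Spine Rec'`).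

HONEST FRAMING.  Bookkeeping over PARAMETERS; no record predicate or shadow lemma of NODE 00 is instantiated here (`Record9` not landed at the time
of writing); nothing of Bałaban's asserted; N27 undischarged (children 0∕1); typed 28∕28, discharged count untouched; one finite four-torus programme —
NOT ℝ⁴, NOT infinite volume, NOT OS, NOT a mass gap, NOT Clay.  Restate-immune.  No decl below carries a cite tag.
-/

namespace Summit.QuantumFields.YangMills.Theorems.BalabanUVNodesN27SpineRecord

open Literature.MathematicalPhysics.QuantumFieldTheory.Balaban1983to89
open Literature.MathematicalPhysics.QuantumFieldTheory.Balaban1983to89.T4Continuum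
open T4ContinuumYM4Torus (ForSmallCouplings)
open YMDAG.UVSplit

/-! ## §1 B5 reads the datum through `(C, av)` only -/

section Congr

variable {F : T4Family} {G : Type*} [GaugeGroup G] [MeasurableSpace G] [HaarData G] {D D' : FiniteEpsData F G}

/-- The averaged loop variables read the datum through its averaging maps only. [bookkeeping] -/
theorem avgObs_congr_av (hav : D'.av = D.av) : D'.avgObs = D.avgObs := by
  funext K C U
  simp only [FiniteEpsData.avgObs, hav]

/-- The Wilson scheme of the datum (lattices `F.P K`, `β_K = (g₀ K)⁻²`, observables = averaged loop variables) reads the datum through `av` only.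
[bookkeeping] -/
theorem scheme_congr_av (hav : D'.av = D.av) : D'.scheme = D.scheme := by
  funext g₀
  simp only [FiniteEpsData.scheme, avgObs_congr_av hav]

/-- Tuning (`g_k ∈ ]0, γ]`, `g_K = g` along the runs of the construction) reads the datum through `C` only. [bookkeeping] -/
theorem tuned_congr_C (hC : D'.C = D.C) : D'.Tuned = D.Tuned := by
  funext γ g g₀
  simp only [FiniteEpsData.Tuned, hC]

/-- The discharged prefix reads the datum through `C` only. [bookkeeping] -/
theorem forSmallCouplings_congr_C (hC : D'.C = D.C) (concl : (ℕ → ℝ) → Prop) :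
    ForSmallCouplings D' concl ↔ ForSmallCouplings D concl := by
  unfold ForSmallCouplings
  rw [tuned_congr_C hC]

/-- **B5-UNDER-`Hβ` IS CONGRUENT UNDER `(C, av)`-AGREEMENT**: `T4ApexHybrid.HybridNE7Under D Hβ = (B)(D.C) → Hβ → ForSmallCouplings D (g₀ ↦
StringwiseHybridNE7 (D.scheme g₀))` reads `D.C` (antecedent (B), tuning) and `D.av` (the scheme's observables) and NOTHING ELSE of the datum — not
`βfun`, not the densities. [bookkeeping] -/
theorem hybridNE7Under_congr (hC : D'.C = D.C) (hav : D'.av = D.av) (Hβ : Prop) :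
    T4ApexHybrid.HybridNE7Under D' Hβ ↔ T4ApexHybrid.HybridNE7Under D Hβ := by
  unfold T4ApexHybrid.HybridNE7Under FiniteEpsData.UnderHypotheses
  rw [scheme_congr_av hav, tuned_congr_C hC, hC]

/-- **BINDER B5 IS CONGRUENT UNDER `(C, av)`-AGREEMENT** (`Hβ := END` of the respective constructions). [bookkeeping] -/
theorem b5_congr (hC : D'.C = D.C) (hav : D'.av = D.av) :
    T4ApexHybrid.HybridNE7Under D' (DagBinding.EndpointExistence D'.C.toB12) ↔
      T4ApexHybrid.HybridNE7Under D (DagBinding.EndpointExistence D.C.toB12) := by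
  rw [hybridNE7Under_congr hC hav, hC]

end Congr

/-! ## §2 The (W2′) SHADOW closer for `Spine` -/

section Shadow

variable {N : ℕ} [NeZero N]

/-- **`Spine` TRANSFERS ALONG `(C, av)`-SHADOWS.**  If every record pair `(D, w)` of `Rec` has a shadow datum `D'` — same world, `Rec' F D' w`,
`D'.C = D.C`, `D'.av = D.av` — then B5 at `Rec'` gives B5 at `Rec` (`b5_congr`).  With `Rec' :=` NODE 00's `₅C` record predicate and `Rec :=` its `₉C`
one this is the (W2′) closer the shadow lemma of `Record9` feeds (COST 2: `₉C → ₅C` at the shadow, not at the datum). [bookkeeping] -/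
theorem spine_of_shadow {Rec Rec' : RecordPred N}
    (hsh : ∀ (F : T4Family) (D : Datum F N) (w : DagBinding.WorldP), Rec F D w →
      ∃ D' : Datum F N, Rec' F D' w ∧ D'.C = D.C ∧ D'.av = D.av)
    (h : Spine Rec') : Spine Rec := by
  intro F D w hR
  obtain ⟨D', hR', hC, hav⟩ := hsh F D w hR
  exact (b5_congr hC hav).mp (h F D' w hR')

/-- Mutual shadows ⇒ `Spine Rec ↔ Spine Rec'`. [bookkeeping] -/
theorem spine_iff_of_biShadow {Rec Rec' : RecordPred N}
    (hsh : ∀ (F : T4Family) (D : Datum F N) (w : DagBinding.WorldP), Rec F D w →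
      ∃ D' : Datum F N, Rec' F D' w ∧ D'.C = D.C ∧ D'.av = D.av)
    (hsh' : ∀ (F : T4Family) (D' : Datum F N) (w : DagBinding.WorldP), Rec' F D' w →
      ∃ D : Datum F N, Rec F D w ∧ D.C = D'.C ∧ D.av = D'.av) :
    Spine Rec ↔ Spine Rec' :=
  ⟨spine_of_shadow hsh', spine_of_shadow hsh⟩

end Shadow

end Summit.QuantumFields.YangMills.Theorems.BalabanUVNodesN27SpineRecord
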